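import Mathlib
import Summits.ValiantsHypothesis.ValiantsHypothesis.Theorems.LacunarySymmetroidMatrixDescartesTwoBlockDominance

/-!
# `MatrixDescartes` (stmt-ValiantsHypothesis-18050) — THE TWO-BLOCK LIMIT LEMMA: for a NON-SINGULAR `C₁₁` and arbitrary
# signs, the inertia of `[[C₁₁ + diag(small), C₁₂], [C₁₂ᵀ, C₂₂ + diag(±huge)]]` is
# `(π(C₁₁) + #{+huge}, ν(C₁₁) + #{−huge}, 0)`

HONEST FRAMING.  Cell `pub-symmetroid`, seat `val-sym-mdr-p2` (gen 21); helper file `--supports` the crux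
`Theses.LacunarySymmetroid.MatrixDescartes` (OPEN), NO closure claim; companion of `…TwoBlockDominance` (the MONOTONE case:
positive small diagonal, negative huge diagonal, `C₁₁` arbitrary).  Pure linear algebra: the END ASYMPTOTICS of the dual of
an ARBITRARY (non-monotone) signed word whose relevant Gram block is non-singular — the engine of the end-inertia / drift
laws for general words (filed next).  Nothing here bears on the crux in its window, `stub_twoSided`, `DoorA26` / `DoorA34`,
registers, or `VP ≠ VNP`.

THE FAMILY.  `C₁₁ : ρ₁ × ρ₁` real symmetric NON-SINGULAR, `C₂₂ : ρ₂ × ρ₂` real symmetric, `C₁₂` arbitrary; weights `αⱼ`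
ARBITRARY, `βⱼ ≠ 0` of ARBITRARY SIGN, exponents `pⱼ, qⱼ ≥ 1`;
`M(s) = [[C₁₁ + diag(αⱼ s^{pⱼ}), C₁₂], [C₁₂ᵀ, C₂₂ + diag((βⱼ s^{qⱼ})⁻¹)]]` (`s > 0` small: a small diagonal of any signs on the
first block, a huge diagonal of signs `sgn βⱼ` on the second).

* `conj_twoBlock'` / `conj_twoBlock'_inv` — with `Λ = 1 ⊕ diag(uⱼ)`, `uⱼ = √(|βⱼ| s^{qⱼ})`: `Λᵀ M(s) Λ = K(s)` and
  `Λ′ᵀ K(s) Λ′ = M(s)` (`Λ′ = 1 ⊕ diag(uⱼ⁻¹)`), where `K(s) = [[C₁₁ + diag(αs^p), C₁₂ diag u], [diag u C₁₂ᵀ,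
  diag u C₂₂ diag u + diag(|βⱼ|/βⱼ)]]` is entrywise continuous on `ℝ` with `K(0) = [[C₁₁, 0], [0, diag(sgn β)]]` NON-SINGULAR.
* `negIndex_limit` / `posIndex_limit` — `ν(K(0)) = ν(C₁₁) + #{β < 0}`, `π(K(0)) = π(C₁₁) + #{β > 0}` (Haynsworth with a zero
  border).
* **`inertia_twoBlock'` (THE TWO-BLOCK LIMIT LEMMA).**  There is `ε > 0` such that for all `s ∈ (0, ε)`:
  `ν(M(s)) = ν(C₁₁) + #{j : βⱼ < 0}`, `π(M(s)) = π(C₁₁) + #{j : βⱼ > 0}`, `det M(s) ≠ 0`.  Mechanism: the indices are locally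
  constant at the non-singular point `K(0)` (`Inertia.eventually_negIndex_eq` + semicontinuity of `π`), and congruence by the
  invertible `Λ` preserves them (rectangular Sylvester `negIndex_conj_le` both ways).  Versus `…TwoBlockDominance`: signs
  are free here, the price is `det C₁₁ ≠ 0` (with a singular `C₁₁` its kernel is split by the competition between the small
  diagonal and the Schur correction, and no sign-free answer exists).

[folklore] (Sylvester's law of inertia; continuity of the spectrum).  Axioms `propext`, `Classical.choice`, `Quot.sound`.
No definitions.
-/

-- layout Summits/ValiantsHypothesis/ValiantsHypothesis forces the duplicated namespace component
set_option linter.dupNamespace false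

namespace Summit.ValiantsHypothesis.ValiantsHypothesis.Theorems.LacunarySymmetroidMatrixDescartes

open Matrix Finset
open scoped BigOperators Topology

namespace Inertia

section TwoBlockLimit

variable {ρ₁ ρ₂ : Type} [Fintype ρ₁] [DecidableEq ρ₁] [Fintype ρ₂] [DecidableEq ρ₂]

/-- the two-block family `M(s)` with a `+` on the second block (file-local notation) -/
local notation3 (prettyPrint := false) "𝕄'[" C₁₁ ", " C₁₂ ", " C₂₂ ", " α ", " p ", " β ", " q ", " s "]" =>
  Matrix.fromBlocks ((C₁₁ : Matrix _ _ ℝ) + Matrix.diagonal (fun j => (α : _ → ℝ) j * (s : ℝ) ^ ((p : _ → ℕ) j)))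
    (C₁₂ : Matrix _ _ ℝ) (C₁₂)ᵀ
    ((C₂₂ : Matrix _ _ ℝ) + Matrix.diagonal (fun j => ((β : _ → ℝ) j * (s : ℝ) ^ ((q : _ → ℕ) j))⁻¹))

/-- the rescaling weights `uⱼ(s) = √(|βⱼ| s^{qⱼ})` (file-local notation) -/
local notation3 (prettyPrint := false) "𝕦'[" β ", " q ", " s "]" =>
  (fun j => Real.sqrt (|(β : _ → ℝ) j| * (s : ℝ) ^ ((q : _ → ℕ) j)))

/-- the rescaled family `K(s) = Λᵀ M(s) Λ` (file-local notation) -/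
local notation3 (prettyPrint := false) "𝕂'[" C₁₁ ", " C₁₂ ", " C₂₂ ", " α ", " p ", " β ", " q ", " s "]" =>
  Matrix.fromBlocks ((C₁₁ : Matrix _ _ ℝ) + Matrix.diagonal (fun j => (α : _ → ℝ) j * (s : ℝ) ^ ((p : _ → ℕ) j)))
    ((C₁₂ : Matrix _ _ ℝ) * Matrix.diagonal (𝕦'[β, q, s]))
    (Matrix.diagonal (𝕦'[β, q, s]) * (C₁₂)ᵀ)
    (Matrix.diagonal (𝕦'[β, q, s]) * (C₂₂ : Matrix _ _ ℝ) * Matrix.diagonal (𝕦'[β, q, s])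
      + Matrix.diagonal (fun j => |(β : _ → ℝ) j| / β j))

/-! ## §1  Symmetry, continuity, the value at `0`, the congruences -/

omit [Fintype ρ₁] [Fintype ρ₂] in
/-- The family is symmetric. [folklore] -/
theorem isHermitian_twoBlock' {C₁₁ : Matrix ρ₁ ρ₁ ℝ} {C₂₂ : Matrix ρ₂ ρ₂ ℝ} (h₁ : C₁₁.IsSymm) (h₂ : C₂₂.IsSymm)
    (C₁₂ : Matrix ρ₁ ρ₂ ℝ) (α : ρ₁ → ℝ) (p : ρ₁ → ℕ) (β : ρ₂ → ℝ) (q : ρ₂ → ℕ) (s : ℝ) :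
    (𝕄'[C₁₁, C₁₂, C₂₂, α, p, β, q, s]).IsHermitian := by
  refine isHermitian_of_isSymm ?_
  rw [Matrix.isSymm_fromBlocks_iff]
  exact ⟨h₁.add (Matrix.isSymm_diagonal _), rfl, Matrix.transpose_transpose _, h₂.add (Matrix.isSymm_diagonal _)⟩

omit [Fintype ρ₁] in
/-- The rescaled family is symmetric. [folklore] -/
theorem isHermitian_rescaled' {C₁₁ : Matrix ρ₁ ρ₁ ℝ} {C₂₂ : Matrix ρ₂ ρ₂ ℝ} (h₁ : C₁₁.IsSymm) (h₂ : C₂₂.IsSymm)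
    (C₁₂ : Matrix ρ₁ ρ₂ ℝ) (α : ρ₁ → ℝ) (p : ρ₁ → ℕ) (β : ρ₂ → ℝ) (q : ρ₂ → ℕ) (s : ℝ) :
    (𝕂'[C₁₁, C₁₂, C₂₂, α, p, β, q, s]).IsHermitian := by
  refine isHermitian_of_isSymm ?_
  rw [Matrix.isSymm_fromBlocks_iff]
  refine ⟨h₁.add (Matrix.isSymm_diagonal _), ?_, ?_, ?_⟩
  · rw [Matrix.transpose_mul, Matrix.diagonal_transpose]
  · rw [Matrix.transpose_mul, Matrix.diagonal_transpose, Matrix.transpose_transpose]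
  · refine Matrix.IsSymm.add ?_ (Matrix.isSymm_diagonal _)
    unfold Matrix.IsSymm
    rw [Matrix.transpose_mul, Matrix.transpose_mul, Matrix.diagonal_transpose, h₂.eq, Matrix.mul_assoc]

omit [Fintype ρ₁] in
/-- The rescaled family has continuous entries. [folklore] -/
theorem continuous_rescaled' (C₁₁ : Matrix ρ₁ ρ₁ ℝ) (C₁₂ : Matrix ρ₁ ρ₂ ℝ) (C₂₂ : Matrix ρ₂ ρ₂ ℝ) (α : ρ₁ → ℝ)
    (p : ρ₁ → ℕ) (β : ρ₂ → ℝ) (q : ρ₂ → ℕ) (i k : ρ₁ ⊕ ρ₂) :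
    Continuous fun s : ℝ => (𝕂'[C₁₁, C₁₂, C₂₂, α, p, β, q, s]) i k := by
  have hu : ∀ j, Continuous fun s : ℝ => Real.sqrt (|β j| * s ^ q j) := fun j =>
    Real.continuous_sqrt.comp (continuous_const.mul (continuous_pow _))
  rcases i with i | i <;> rcases k with k | k
  · simp only [Matrix.fromBlocks_apply₁₁, Matrix.add_apply, Matrix.diagonal_apply]
    split_ifs <;> fun_prop
  · simp only [Matrix.fromBlocks_apply₁₂, Matrix.mul_diagonal]
    exact continuous_const.mul (hu k)
  · simp only [Matrix.fromBlocks_apply₂₁, Matrix.diagonal_mul]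
    exact (hu i).mul continuous_const
  · simp only [Matrix.fromBlocks_apply₂₂, Matrix.add_apply, Matrix.mul_diagonal, Matrix.diagonal_mul]
    exact (((hu i).mul continuous_const).mul (hu k)).add continuous_const

omit [Fintype ρ₁] in
/-- The rescaled family at `s = 0` is `[[C₁₁, 0], [0, diag(|β|/β)]]` (`pⱼ, qⱼ ≥ 1`). [folklore] -/
theorem rescaled'_zero (C₁₁ : Matrix ρ₁ ρ₁ ℝ) (C₁₂ : Matrix ρ₁ ρ₂ ℝ) (C₂₂ : Matrix ρ₂ ρ₂ ℝ) (α : ρ₁ → ℝ)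
    {p : ρ₁ → ℕ} (β : ρ₂ → ℝ) {q : ρ₂ → ℕ} (hp : ∀ j, 1 ≤ p j) (hq : ∀ j, 1 ≤ q j) :
    𝕂'[C₁₁, C₁₂, C₂₂, α, p, β, q, (0 : ℝ)] = Matrix.fromBlocks C₁₁ 0 0 (Matrix.diagonal (fun j => |β j| / β j)) := by
  have hu : (fun j => Real.sqrt (|β j| * (0 : ℝ) ^ q j)) = fun _ => 0 := by
    funext j
    rw [zero_pow (by have := hq j; omega), mul_zero, Real.sqrt_zero]
  have hd : Matrix.diagonal (fun j => α j * (0 : ℝ) ^ p j) = 0 := by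
    rw [← Matrix.diagonal_zero]
    congr 1
    funext j
    rw [zero_pow (by have := hp j; omega), mul_zero]
  rw [hu, hd, Matrix.diagonal_zero, Matrix.mul_zero, Matrix.zero_mul, Matrix.zero_mul, Matrix.mul_zero, add_zero,
    zero_add]

/-- **`Λᵀ M(s) Λ = K(s)`** for `s > 0`, `Λ = 1 ⊕ diag(√(|βⱼ| s^{qⱼ}))`. [folklore] -/
theorem conj_twoBlock' (C₁₁ : Matrix ρ₁ ρ₁ ℝ) (C₁₂ : Matrix ρ₁ ρ₂ ℝ) (C₂₂ : Matrix ρ₂ ρ₂ ℝ) (α : ρ₁ → ℝ)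
    (p : ρ₁ → ℕ) (β : ρ₂ → ℝ) (q : ρ₂ → ℕ) {s : ℝ} (hs : 0 < s) :
    (Matrix.fromBlocks (1 : Matrix ρ₁ ρ₁ ℝ) 0 0 (Matrix.diagonal (𝕦'[β, q, s])))ᵀ
        * 𝕄'[C₁₁, C₁₂, C₂₂, α, p, β, q, s] * Matrix.fromBlocks (1 : Matrix ρ₁ ρ₁ ℝ) 0 0 (Matrix.diagonal (𝕦'[β, q, s]))
      = 𝕂'[C₁₁, C₁₂, C₂₂, α, p, β, q, s] := by
  have hu2 : ∀ j, Real.sqrt (|β j| * s ^ q j) * (β j * s ^ q j)⁻¹ * Real.sqrt (|β j| * s ^ q j) = |β j| / β j := by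
    intro j
    have hsq : 0 < s ^ q j := pow_pos hs _
    have hnn : 0 ≤ |β j| * s ^ q j := mul_nonneg (abs_nonneg _) hsq.le
    calc Real.sqrt (|β j| * s ^ q j) * (β j * s ^ q j)⁻¹ * Real.sqrt (|β j| * s ^ q j)
        = (Real.sqrt (|β j| * s ^ q j) * Real.sqrt (|β j| * s ^ q j)) * (β j * s ^ q j)⁻¹ := by ring
      _ = |β j| / β j := by
          rw [Real.mul_self_sqrt hnn, mul_inv]
          field_simp
  rw [Matrix.fromBlocks_transpose, Matrix.transpose_one, Matrix.transpose_zero, Matrix.transpose_zero,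
    Matrix.diagonal_transpose, Matrix.fromBlocks_multiply, Matrix.fromBlocks_multiply]
  simp only [Matrix.one_mul, Matrix.zero_mul, Matrix.mul_zero, add_zero, zero_add, Matrix.mul_one]
  rw [Matrix.mul_add, Matrix.add_mul, Matrix.diagonal_mul_diagonal, Matrix.diagonal_mul_diagonal]
  congr 3
  funext j
  exact hu2 j

/-- **`Λ′ᵀ K(s) Λ′ = M(s)`** for `s > 0`, `Λ′ = 1 ⊕ diag(uⱼ⁻¹)` — the inverse congruence. [folklore] -/
theorem conj_twoBlock'_inv (C₁₁ : Matrix ρ₁ ρ₁ ℝ) (C₁₂ : Matrix ρ₁ ρ₂ ℝ) (C₂₂ : Matrix ρ₂ ρ₂ ℝ) (α : ρ₁ → ℝ)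
    (p : ρ₁ → ℕ) {β : ρ₂ → ℝ} (q : ρ₂ → ℕ) (hβ : ∀ j, β j ≠ 0) {s : ℝ} (hs : 0 < s) :
    (Matrix.fromBlocks (1 : Matrix ρ₁ ρ₁ ℝ) 0 0 (Matrix.diagonal (fun j => (𝕦'[β, q, s] j)⁻¹)))ᵀ
        * 𝕂'[C₁₁, C₁₂, C₂₂, α, p, β, q, s]
        * Matrix.fromBlocks (1 : Matrix ρ₁ ρ₁ ℝ) 0 0 (Matrix.diagonal (fun j => (𝕦'[β, q, s] j)⁻¹))
      = 𝕄'[C₁₁, C₁₂, C₂₂, α, p, β, q, s] := by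
  have hu : ∀ j, Real.sqrt (|β j| * s ^ q j) ≠ 0 := fun j =>
    (Real.sqrt_pos.2 (mul_pos (abs_pos.2 (hβ j)) (pow_pos hs _))).ne'
  have hu2 : ∀ j, (Real.sqrt (|β j| * s ^ q j))⁻¹ * (|β j| / β j) * (Real.sqrt (|β j| * s ^ q j))⁻¹
      = (β j * s ^ q j)⁻¹ := by
    intro j
    have hsq : 0 < s ^ q j := pow_pos hs _
    have hnn : 0 ≤ |β j| * s ^ q j := mul_nonneg (abs_nonneg _) hsq.le
    have hss : Real.sqrt (|β j| * s ^ q j) * Real.sqrt (|β j| * s ^ q j) = |β j| * s ^ q j := Real.mul_self_sqrt hnn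
    have hβj := hβ j
    have habs : |β j| ≠ 0 := abs_ne_zero.2 hβj
    calc (Real.sqrt (|β j| * s ^ q j))⁻¹ * (|β j| / β j) * (Real.sqrt (|β j| * s ^ q j))⁻¹
        = (|β j| / β j) * (Real.sqrt (|β j| * s ^ q j) * Real.sqrt (|β j| * s ^ q j))⁻¹ := by rw [mul_inv]; ring
      _ = (|β j| / β j) * (|β j| * s ^ q j)⁻¹ := by rw [hss]
      _ = (β j * s ^ q j)⁻¹ := by field_simp
  have hcancel : ∀ j, Real.sqrt (|β j| * s ^ q j) * (Real.sqrt (|β j| * s ^ q j))⁻¹ = 1 := fun j =>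
    mul_inv_cancel₀ (hu j)
  have hcancel' : ∀ j, (Real.sqrt (|β j| * s ^ q j))⁻¹ * Real.sqrt (|β j| * s ^ q j) = 1 := fun j =>
    inv_mul_cancel₀ (hu j)
  rw [Matrix.fromBlocks_transpose, Matrix.transpose_one, Matrix.transpose_zero, Matrix.transpose_zero,
    Matrix.diagonal_transpose, Matrix.fromBlocks_multiply, Matrix.fromBlocks_multiply]
  simp only [Matrix.one_mul, Matrix.zero_mul, Matrix.mul_zero, add_zero, zero_add, Matrix.mul_one]
  rw [Matrix.fromBlocks_inj]
  refine ⟨rfl, ?_, ?_, ?_⟩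
  · rw [Matrix.mul_assoc, Matrix.diagonal_mul_diagonal]
    conv_rhs => rw [← Matrix.mul_one C₁₂]
    congr 1
    rw [← Matrix.diagonal_one]
    congr 1
    funext j
    exact hcancel j
  · rw [← Matrix.mul_assoc, Matrix.diagonal_mul_diagonal]
    conv_rhs => rw [← Matrix.one_mul C₁₂ᵀ]
    congr 1
    rw [← Matrix.diagonal_one]
    congr 1
    funext j
    exact hcancel' j
  · rw [Matrix.mul_add, Matrix.add_mul, Matrix.diagonal_mul_diagonal, Matrix.diagonal_mul_diagonal]
    have h1 : Matrix.diagonal (fun j => (Real.sqrt (|β j| * s ^ q j))⁻¹)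
        * (Matrix.diagonal (𝕦'[β, q, s]) * C₂₂ * Matrix.diagonal (𝕦'[β, q, s]))
        * Matrix.diagonal (fun j => (Real.sqrt (|β j| * s ^ q j))⁻¹) = C₂₂ := by
      rw [Matrix.mul_assoc, Matrix.mul_assoc, Matrix.diagonal_mul_diagonal, ← Matrix.mul_assoc, ← Matrix.mul_assoc,
        Matrix.diagonal_mul_diagonal]
      have e1 : Matrix.diagonal (fun j => (Real.sqrt (|β j| * s ^ q j))⁻¹ * Real.sqrt (|β j| * s ^ q j)) = 1 := by
        rw [← Matrix.diagonal_one]; congr 1; funext j; exact hcancel' j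
      have e2 : Matrix.diagonal (fun j => Real.sqrt (|β j| * s ^ q j) * (Real.sqrt (|β j| * s ^ q j))⁻¹) = 1 := by
        rw [← Matrix.diagonal_one]; congr 1; funext j; exact hcancel j
      rw [e1, e2, Matrix.one_mul, Matrix.mul_one]
    rw [h1]
    congr 2
    funext j
    exact hu2 j

/-! ## §2  The inertia of the limit `[[C₁₁, 0], [0, diag(sgn β)]]` -/

/-- **Block-diagonal inertia** (Haynsworth with a zero border): `ν([[A, 0], [0, D]]) = ν(A) + ν(D)` for real symmetric
`A` with `det A ≠ 0` and real symmetric `D`. [folklore] -/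
theorem negIndex_fromBlocks_diag {A : Matrix ρ₁ ρ₁ ℝ} {D : Matrix ρ₂ ρ₂ ℝ} (hA : A.IsSymm) (hAu : IsUnit A.det)
    (hAH : A.IsHermitian) (hDH : D.IsHermitian) (hM : (Matrix.fromBlocks A 0 0 D).IsHermitian) :
    Fintype.card {j // hM.eigenvalues j < 0}
      = Fintype.card {j // hAH.eigenvalues j < 0} + Fintype.card {j // hDH.eigenvalues j < 0} := by
  have h0 : (0 : Matrix ρ₁ ρ₂ ℝ)ᵀ = 0 := Matrix.transpose_zero
  have hS : (D - (0 : Matrix ρ₁ ρ₂ ℝ)ᵀ * A⁻¹ * (0 : Matrix ρ₁ ρ₂ ℝ)).IsHermitian := by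
    rw [Matrix.mul_zero, sub_zero]; exact hDH
  have hM' : (Matrix.fromBlocks A 0 (0 : Matrix ρ₁ ρ₂ ℝ)ᵀ D).IsHermitian := by rw [h0]; exact hM
  have h := GramDual.negIndex_fromBlocks_eq hA hAu 0 D hAH hS hM'
  rw [negIndex_congr hM' hM (by rw [h0]), negIndex_congr hS hDH (by rw [Matrix.mul_zero, sub_zero])] at h
  exact h

/-- Positive-index form: `π([[A, 0], [0, D]]) = π(A) + π(D)`. [folklore] -/
theorem posIndex_fromBlocks_diag {A : Matrix ρ₁ ρ₁ ℝ} {D : Matrix ρ₂ ρ₂ ℝ} (hA : A.IsSymm) (hAu : IsUnit A.det)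
    (hAH : A.IsHermitian) (hDH : D.IsHermitian) (hM : (Matrix.fromBlocks A 0 0 D).IsHermitian) :
    Fintype.card {j // 0 < hM.eigenvalues j}
      = Fintype.card {j // 0 < hAH.eigenvalues j} + Fintype.card {j // 0 < hDH.eigenvalues j} := by
  have h0 : (0 : Matrix ρ₁ ρ₂ ℝ)ᵀ = 0 := Matrix.transpose_zero
  have hS : (D - (0 : Matrix ρ₁ ρ₂ ℝ)ᵀ * A⁻¹ * (0 : Matrix ρ₁ ρ₂ ℝ)).IsHermitian := by
    rw [Matrix.mul_zero, sub_zero]; exact hDH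
  have hM' : (Matrix.fromBlocks A 0 (0 : Matrix ρ₁ ρ₂ ℝ)ᵀ D).IsHermitian := by rw [h0]; exact hM
  have h := GramDual.posIndex_fromBlocks_eq hA hAu 0 D hAH hS hM'
  rw [posIndex_congr hM' hM (by rw [h0]), posIndex_congr hS hDH (by rw [Matrix.mul_zero, sub_zero])] at h
  exact h

omit [Fintype ρ₁] [DecidableEq ρ₁] in
/-- `ν(diag(|β|/β)) = #{β < 0}` for non-zero `β`. [folklore] -/
theorem negIndex_signDiagonal (β : ρ₂ → ℝ) (hβ : ∀ j, β j ≠ 0)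
    (hD : (Matrix.diagonal (fun j => |β j| / β j)).IsHermitian) :
    Fintype.card {j // hD.eigenvalues j < 0} = Fintype.card {j // β j < 0} := by
  rw [GramDual.negIndex_diagonal _ hD]
  refine Fintype.card_congr (Equiv.subtypeEquivRight fun j => ?_)
  rcases lt_or_gt_of_ne (hβ j) with h | h
  · rw [abs_of_neg h, neg_div, div_self h.ne, neg_lt_zero]
    exact ⟨fun _ => h, fun _ => one_pos⟩
  · rw [abs_of_pos h, div_self h.ne']
    exact ⟨fun h1 => absurd h1 (not_lt.2 zero_le_one), fun h1 => absurd h1 (not_lt.2 h.le)⟩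

omit [Fintype ρ₁] [DecidableEq ρ₁] in
/-- `π(diag(|β|/β)) = #{0 < β}` for non-zero `β`. [folklore] -/
theorem posIndex_signDiagonal (β : ρ₂ → ℝ) (hβ : ∀ j, β j ≠ 0)
    (hD : (Matrix.diagonal (fun j => |β j| / β j)).IsHermitian) :
    Fintype.card {j // 0 < hD.eigenvalues j} = Fintype.card {j // 0 < β j} := by
  rw [GramDual.posIndex_diagonal _ hD]
  refine Fintype.card_congr (Equiv.subtypeEquivRight fun j => ?_)
  rcases lt_or_gt_of_ne (hβ j) with h | h
  · rw [abs_of_neg h, neg_div, div_self h.ne, neg_pos]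
    exact ⟨fun h1 => absurd h1 (not_lt.2 zero_le_one), fun h1 => absurd h1 (not_lt.2 h.le)⟩
  · rw [abs_of_pos h, div_self h.ne']
    exact ⟨fun _ => h, fun _ => one_pos⟩

/-! ## §3  The two-block limit lemma -/

/-- **THE TWO-BLOCK LIMIT LEMMA.**  `C₁₁` real symmetric NON-SINGULAR, `C₂₂` real symmetric, `C₁₂` arbitrary, `αⱼ`
arbitrary, `βⱼ ≠ 0` of any signs, `pⱼ, qⱼ ≥ 1`.  There is `ε > 0` such that for every `s ∈ (0, ε)` the matrix
`M(s) = [[C₁₁ + diag(αⱼs^{pⱼ}), C₁₂], [C₁₂ᵀ, C₂₂ + diag((βⱼs^{qⱼ})⁻¹)]]` has `ν(M(s)) = ν(C₁₁) + #{β < 0}`,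
`π(M(s)) = π(C₁₁) + #{β > 0}` and `det M(s) ≠ 0`. [folklore] -/
theorem inertia_twoBlock' {C₁₁ : Matrix ρ₁ ρ₁ ℝ} {C₂₂ : Matrix ρ₂ ρ₂ ℝ} (h₁ : C₁₁.IsSymm) (h₂ : C₂₂.IsSymm)
    (C₁₂ : Matrix ρ₁ ρ₂ ℝ) (α : ρ₁ → ℝ) {p : ρ₁ → ℕ} {β : ρ₂ → ℝ} {q : ρ₂ → ℕ} (hC₁₁ : IsUnit C₁₁.det)
    (hβ : ∀ j, β j ≠ 0) (hp : ∀ j, 1 ≤ p j) (hq : ∀ j, 1 ≤ q j) (hC : C₁₁.IsHermitian) :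
    ∃ ε : ℝ, 0 < ε ∧ ∀ s : ℝ, 0 < s → s < ε →
      Fintype.card {j // (isHermitian_twoBlock' h₁ h₂ C₁₂ α p β q s).eigenvalues j < 0}
          = Fintype.card {j // hC.eigenvalues j < 0} + Fintype.card {j // β j < 0}
        ∧ Fintype.card {j // 0 < (isHermitian_twoBlock' h₁ h₂ C₁₂ α p β q s).eigenvalues j}
          = Fintype.card {j // 0 < hC.eigenvalues j} + Fintype.card {j // 0 < β j}
        ∧ (𝕄'[C₁₁, C₁₂, C₂₂, α, p, β, q, s]).det ≠ 0 := by
  classical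
  set K : ℝ → Matrix (ρ₁ ⊕ ρ₂) (ρ₁ ⊕ ρ₂) ℝ := fun s => 𝕂'[C₁₁, C₁₂, C₂₂, α, p, β, q, s] with hKdef
  have hKH : ∀ s, (K s).IsHermitian := fun s => isHermitian_rescaled' h₁ h₂ C₁₂ α p β q s
  have hcont : ∀ i k, Continuous fun s => K s i k := continuous_rescaled' C₁₁ C₁₂ C₂₂ α p β q
  have hK0 : K 0 = Matrix.fromBlocks C₁₁ 0 0 (Matrix.diagonal (fun j => |β j| / β j)) :=
    rescaled'_zero C₁₁ C₁₂ C₂₂ α β hp hq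
  have hDH : (Matrix.diagonal (fun j => |β j| / β j)).IsHermitian := isHermitian_of_isSymm (Matrix.isSymm_diagonal _)
  have hL : (Matrix.fromBlocks C₁₁ 0 0 (Matrix.diagonal (fun j => |β j| / β j))).IsHermitian := by
    rw [← hK0]; exact hKH 0
  have hdet0 : (K 0).det ≠ 0 := by
    rw [hK0, Matrix.det_fromBlocks_zero₂₁, Matrix.det_diagonal]
    exact mul_ne_zero hC₁₁.ne_zero (Finset.prod_ne_zero_iff.2 fun j _ => div_ne_zero (abs_ne_zero.2 (hβ j)) (hβ j))
  have hν0 : Fintype.card {j // (hKH 0).eigenvalues j < 0}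
      = Fintype.card {j // hC.eigenvalues j < 0} + Fintype.card {j // β j < 0} := by
    rw [negIndex_congr (hKH 0) hL hK0, negIndex_fromBlocks_diag h₁ hC₁₁ hC hDH hL, negIndex_signDiagonal β hβ hDH]
  have hπ0 : Fintype.card {j // 0 < (hKH 0).eigenvalues j}
      = Fintype.card {j // 0 < hC.eigenvalues j} + Fintype.card {j // 0 < β j} := by
    rw [posIndex_congr (hKH 0) hL hK0, posIndex_fromBlocks_diag h₁ hC₁₁ hC hDH hL, posIndex_signDiagonal β hβ hDH]
  have hcnt0 := (negIndex_add_posIndex_add_corank (hKH 0)).1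
  rw [corank_eq_zero_of_det_ne_zero hdet0, add_zero] at hcnt0
  -- local constancy at the non-singular point `0`
  have hev := (eventually_negIndex_eq K hcont hKH 0 hdet0).and (eventually_posIndex_ge K hcont hKH 0)
  rw [Metric.eventually_nhds_iff] at hev
  obtain ⟨ε, hε, hε'⟩ := hev
  refine ⟨ε, hε, fun s hs hsε => ?_⟩
  obtain ⟨hνK, hπK⟩ := hε' (y := s) (by rw [Real.dist_eq, sub_zero, abs_of_pos hs]; exact hsε)
  have hcntK := (negIndex_add_posIndex_add_corank (hKH s)).1
  have hπK' : Fintype.card {j // 0 < (hKH s).eigenvalues j} = Fintype.card {j // 0 < (hKH 0).eigenvalues j} := by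
    omega
  -- transfer to `M(s)` through the congruences
  have hM := isHermitian_twoBlock' h₁ h₂ C₁₂ α p β q s
  have hconj := conj_twoBlock' C₁₁ C₁₂ C₂₂ α p β q hs
  have hconj' := conj_twoBlock'_inv C₁₁ C₁₂ C₂₂ α p q hβ hs
  have hK1 : ((Matrix.fromBlocks (1 : Matrix ρ₁ ρ₁ ℝ) 0 0 (Matrix.diagonal (𝕦'[β, q, s])))ᵀ
      * 𝕄'[C₁₁, C₁₂, C₂₂, α, p, β, q, s]
      * Matrix.fromBlocks (1 : Matrix ρ₁ ρ₁ ℝ) 0 0 (Matrix.diagonal (𝕦'[β, q, s]))).IsHermitian := by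
    rw [hconj]; exact hKH s
  have hM1 : ((Matrix.fromBlocks (1 : Matrix ρ₁ ρ₁ ℝ) 0 0 (Matrix.diagonal (fun j => (𝕦'[β, q, s] j)⁻¹)))ᵀ
      * 𝕂'[C₁₁, C₁₂, C₂₂, α, p, β, q, s]
      * Matrix.fromBlocks (1 : Matrix ρ₁ ρ₁ ℝ) 0 0 (Matrix.diagonal (fun j => (𝕦'[β, q, s] j)⁻¹))).IsHermitian := by
    rw [hconj']; exact hM
  have hν1 := GramDual.negIndex_conj_le hM _ hK1
  have hν2 := GramDual.negIndex_conj_le (hKH s) _ hM1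
  have hπ1 := GramDual.posIndex_conj_le hM _ hK1
  have hπ2 := GramDual.posIndex_conj_le (hKH s) _ hM1
  rw [negIndex_congr hK1 (hKH s) hconj] at hν1
  rw [negIndex_congr hM1 hM hconj'] at hν2
  rw [posIndex_congr hK1 (hKH s) hconj] at hπ1
  rw [posIndex_congr hM1 hM hconj'] at hπ2
  have hνM : Fintype.card {j // hM.eigenvalues j < 0}
      = Fintype.card {j // hC.eigenvalues j < 0} + Fintype.card {j // β j < 0} := by
    have : Fintype.card {j // hM.eigenvalues j < 0} = Fintype.card {j // (hKH s).eigenvalues j < 0} :=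
      le_antisymm hν2 hν1
    rw [this, hνK, hν0]
  have hπM : Fintype.card {j // 0 < hM.eigenvalues j}
      = Fintype.card {j // 0 < hC.eigenvalues j} + Fintype.card {j // 0 < β j} := by
    have : Fintype.card {j // 0 < hM.eigenvalues j} = Fintype.card {j // 0 < (hKH s).eigenvalues j} :=
      le_antisymm hπ2 hπ1
    rw [this, hπK', hπ0]
  refine ⟨hνM, hπM, det_ne_zero_of_indices hM ?_⟩
  rw [hνM, hπM, Fintype.card_sum]
  have hcntC := (negIndex_add_posIndex_add_corank hC).1
  rw [corank_eq_zero_of_det_ne_zero hC₁₁.ne_zero, add_zero] at hcntC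
  have hβsplit : Fintype.card {j // β j < 0} + Fintype.card {j // 0 < β j} = Fintype.card ρ₂ := by
    rw [Fintype.card_subtype, Fintype.card_subtype, ← Finset.card_union_of_disjoint, ← Finset.card_univ]
    · congr 1
      ext j
      simp only [Finset.mem_union, Finset.mem_filter, Finset.mem_univ, true_and, iff_true]
      exact (lt_or_gt_of_ne (hβ j))
    · rw [Finset.disjoint_filter]
      intro j _ h1 h2
      exact lt_asymm h1 h2
  omega

end TwoBlockLimit

end Inertia

end Summit.ValiantsHypothesis.ValiantsHypothesis.Theorems.LacunarySymmetroidMatrixDescartes
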